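import Summits.AnomalousDissipation.AnomalousDissipation.Theorems.QuarticTightness.Negative.Anatomy

/-!
# Route MomentParity / QuarticLadder · crux `QuarticTightness` (stmt-AnomalousDissipation-14331):
# the vacuous route — the crux is implied by the NEGATION of the rank-2 crux `QuarticGate` (stmt-AnomalousDissipation-11464)

Support file of the line lead (continuation c13), for the record of the crux's dependency structure. The hypothesis of
`QuarticTightness` at `(f, ν, E, ε)` is the body `GateHyp f ν E ε` of `QuarticGate`; so if NO admissible force carries
the gate hypothesis along any null viscosity sequence (`¬ QuarticGate`: a universal order-4 quietness theorem, itself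
zeroth-law-grade and the subject of crux stmt-AnomalousDissipation-11464), the crux holds with nothing to show
(`stub_quarticTightnessOfNotQuarticGate`, registered calibration stub S16 of the line's skeleton); contrapositively a
refutation of the crux PROVES `QuarticGate` (`quarticGate_of_not_quarticTightness`). Together with the landed
`MomentParityQuarticTightness.stub_quarticTightnessIffGateInvariantFamily` (the crux ⟺ "gate hypothesis ⇒ loud bounded
Galerkin-invariant family") this places the crux exactly between the two open endpoints ¬`QuarticGate` and the
Galerkin-ensemble floor of the gate-passing forces. Pure logic over `Theorems/QuarticTightness/Negative/Anatomy.lean`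
(cf. the strategist's `Cruxes/QuarticTightness/StrategyCensus.lean` §0, where both are kernel-checked as workfile lemmas).
-/

noncomputable section

-- `Summit.<Summit>.<Problem>` is the tree's mandated summit-side namespace (CONVENTIONS §2); for this
-- single-conjunct summit the two coincide, so the duplicate is deliberate.
set_option linter.dupNamespace false

namespace Summit.AnomalousDissipation.AnomalousDissipation.Theorems.MomentParityQuarticTightness

open MeasureTheory Filter Topology Set Function
open scoped ENNReal InnerProductSpace RealInnerProductSpace
open Literature.Analysis.FunctionSpaces Literature.Analysis.FunctionSpaces.Torus
open Literature.Analysis.FluidPDE Literature.Analysis.FluidPDE.Torus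
open Summit.AnomalousDissipation.AnomalousDissipation.Theses.MomentParity
open Summit.AnomalousDissipation.AnomalousDissipation.Theorems
open Summit.AnomalousDissipation.AnomalousDissipation.Theorems.QuarticGate.Negative
open Summit.AnomalousDissipation.AnomalousDissipation.Theorems.QuarticTightness.Negative

-- `T3 = T³`, `R3 = ℝ³`, `H3 = H`, `L2T3 = L²(T³; ℝ³)` (sibling crux's abbreviations).
open Summit.AnomalousDissipation.AnomalousDissipation.Theorems.CubicParityLoud.Negative (T3 R3 H3 L2T3)

/-- **¬`QuarticGate` ⇒ `QuarticTightness` (vacuously).** If no admissible force carries the gate hypothesis along any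
positive null viscosity sequence with any budgets `E`, `ε > 0`, the implication of the crux has an empty hypothesis.
Registered calibration stub S16 of the line's skeleton. [folklore] -/
theorem stub_quarticTightnessOfNotQuarticGate : ¬ QuarticGate → QuarticTightness := by
  intro h
  rw [quarticTightness_iff]
  intro f hfs hfd hfz ν E ε hν hν0 hε hH
  exact absurd (quarticGate_iff.2 ⟨f, hfs, hfd, hfz, ν, E, ε, hν, hν0, hε, hH⟩) h

/-- **A refutation of the crux proves `QuarticGate`**: the counterexample force carries the gate hypothesis.
[folklore] -/
theorem quarticGate_of_not_quarticTightness (h : ¬ QuarticTightness) : QuarticGate := by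
  by_contra hG
  exact h (stub_quarticTightnessOfNotQuarticGate hG)

end Summit.AnomalousDissipation.AnomalousDissipation.Theorems.MomentParityQuarticTightness

end
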